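import Literature.MathematicalPhysics.QuantumLattice.PairedProductStates
import Literature.MathematicalPhysics.QuantumLattice.PairFieldMomentum
import Literature.MathematicalPhysics.QuantumLattice.FreeFermionSectorEnergyDeviation
import HarnessLib

/-!
# The on-site interaction in momentum space and the doublon density `n²/L²` of the paired Fermi sea

Family `hubbard` / trunk T-QLATTICE. Companion of `PairedProductStates.lean` (the fully paired product
vectors `Φ_l = Π_{k∈l} b†_k |0⟩`, `b†_k = c†_{k↑} c†_{-k↓}`, their normalisation and kinetic energy).
Here the Hubbard on-site repulsion `Σ_x n_{x↑} n_{x↓}` of the torus `(ℤ/Lℤ)²` is written in the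
pair (Cooper) channel in momentum space and evaluated on `Φ_l`:

* `numberOp_mul_numberOp_eq` — `n_{x↑} n_{x↓} = (c_{x↓}c_{x↑})ᴴ (c_{x↓}c_{x↑})` (real-space CAR);
* `sum_conj_torusChar_smul_onsitePair` — the Fourier mode of the on-site pair is the pair operator of
  total momentum `m`: `Σ_x conj χ_m(x) • c_{x↓}c_{x↑} = Σ_k c_{m-k,↓} c_{k,↑}` (Fourier inversion
  `annihilation_orb_eq_sum_momentumAnnihilation` twice and character orthogonality);
* `interaction_eq_sum_pairMomentum` — **`Σ_x n_{x↑}n_{x↓} = L⁻² Σ_m F_mᴴ F_m`**, `F_m = Σ_k c_{m-k,↓}c_{k,↑}`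
  (the operator Plancherel identity `sum_conjTranspose_mul_fourierMode` read backwards);
* `star_pairedState_pairMomentum_expect` — `⟨Φ_l, F_mᴴ F_m Φ_l⟩ = #{k ∈ l : k - m ∈ l}` for duplicate-free
  `l` (diagonal terms are products of Bloch occupations, `star_pairTerm_dotProduct_pairTerm_self`;
  off-diagonal ones vanish by `n_{k↑} c_{k↑} = 0`, `star_pairTerm_dotProduct_pairTerm_of_ne`), and the
  lattice count `sum_sum_ite_mem_and_sub_mem`: `Σ_m #{k ∈ l : k - m ∈ l} = |l|²`;
* `re_expect_interaction_pairedState` — **`Re⟨Φ_l, Σ_x n_{x↑}n_{x↓} Φ_l⟩ = |l|²/L²`**: the doublon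
  density of the paramagnetic paired Fermi sea is EXACTLY `(n/L²)²·L²` (up and down densities `n/L²` are
  uncorrelated), i.e. the Hartree–Fock interaction energy `U n²/L²` of the `(n, n)` Slater determinant —
  the input that turns the crude `⟨D⟩ ≤ n` of the Stoner-type variational bounds into the sharp one.

Sources: J. Bardeen, L. N. Cooper, J. R. Schrieffer, Phys. Rev. 108 (1957) 1175, §II (pair operators
`b_k`); D. R. Penn, Phys. Rev. 142 (1966) 350, §II (Hartree–Fock energy `U n↑ n↓` per site of the
paramagnetic state of the Hubbard model); E. H. Lieb, M. Loss, *Analysis* (2001) (Plancherel on finite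
abelian groups, §10). Textbook manipulations; no named facts, no definitions, no sorry.
-/

noncomputable section

namespace Literature.MathematicalPhysics.QuantumLattice

open Matrix Finset Literature.Probability.LatticeModels
open scoped ComplexOrder ComplexConjugate

variable {L : ℕ} [NeZero L]

/-! ### The on-site pair and its Fourier modes -/

omit [NeZero L] in
/-- **`n_{x↑} n_{x↓} = (c_{x↓} c_{x↑})ᴴ (c_{x↓} c_{x↑})`** on the fermionic torus (twice the CAR between
the two orbitals of the site `x`). [folklore] -/
theorem numberOp_mul_numberOp_eq (x : FermionTorus 2 L) :
    numberOp x 0 * numberOp x 1 =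
      (annihilation (orb x 1) * annihilation (orb x 0))ᴴ * (annihilation (orb x 1) * annihilation (orb x 0)) := by
  have hne : orb x (0 : Fin 2) ≠ orb x 1 := fun h => absurd (orb_eq_orb_iff.1 h).2 (by decide)
  have h1 : annihilation (orb x 0) * creation (orb x 1) = -(creation (orb x 1) * annihilation (orb x 0)) := by
    have h := annihilation_mul_creation_add_torus (orb x (0 : Fin 2)) (orb x 1)
    rw [if_neg hne] at h
    exact eq_neg_of_add_eq_zero_left h
  have h2 : annihilation (orb x 0) * annihilation (orb x 1) = -(annihilation (orb x 1) * annihilation (orb x 0)) :=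
    eq_neg_of_add_eq_zero_left (annihilation_anticommute_holds (orb x (0 : Fin 2)) (orb x 1))
  rw [conjTranspose_mul, annihilation_conjTranspose, annihilation_conjTranspose]
  unfold numberOp
  calc creation (orb x 0) * annihilation (orb x 0) * (creation (orb x 1) * annihilation (orb x 1))
      = creation (orb x 0) * (annihilation (orb x 0) * creation (orb x 1)) * annihilation (orb x 1) := by
        simp only [Matrix.mul_assoc]
    _ = -(creation (orb x 0) * creation (orb x 1) * (annihilation (orb x 0) * annihilation (orb x 1))) := by
        rw [h1]; simp only [Matrix.mul_neg, Matrix.neg_mul, Matrix.mul_assoc]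
    _ = creation (orb x 0) * creation (orb x 1) * (annihilation (orb x 1) * annihilation (orb x 0)) := by
        rw [h2, Matrix.mul_neg, neg_neg]

omit [NeZero L] in
/-- `χ_{k+k'}(x) = χ_k(x) χ_{k'}(x)` (characters of `(ℤ/Lℤ)^d` in the momentum variable). [folklore] -/
private theorem torusChar_add_left' {d : ℕ} [NeZero L] (k k' x : TorusSite d L) :
    torusChar (k + k') x = torusChar k x * torusChar k' x := by
  rw [torusChar_comm, torusChar_add_right, torusChar_comm x k, torusChar_comm x k']

/-- Character orthogonality with the unitary weights: `Σ_x L⁻¹χ_a(x) · L⁻¹χ_b(x) · conj χ_m(x) = [a + b = m]`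
on `(ℤ/Lℤ)²`. [folklore] -/
theorem sum_weight_torusChar_mul_weight_torusChar_mul_conj (a b m : TorusSite 2 L) :
    ∑ x : TorusSite 2 L, torusFourierWeight 2 L * torusChar a x * (torusFourierWeight 2 L * torusChar b x) *
        conj (torusChar m x) = if a + b = m then 1 else 0 := by
  have h := sum_torusChar_right (a + b - m)
  simp only [torusChar_sub_left, torusChar_add_left'] at h
  calc ∑ x : TorusSite 2 L, torusFourierWeight 2 L * torusChar a x * (torusFourierWeight 2 L * torusChar b x) *
        conj (torusChar m x)
      = torusFourierWeight 2 L * torusFourierWeight 2 L *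
          ∑ x : TorusSite 2 L, torusChar a x * torusChar b x * conj (torusChar m x) := by
        rw [Finset.mul_sum]
        exact Finset.sum_congr rfl fun x _ => by ring
    _ = if a + b = m then 1 else 0 := by
        rw [h]
        simp only [sub_eq_zero]
        split_ifs
        · exact torusFourierWeight_mul_self_mul_pow
        · exact mul_zero _

/-- **The Fourier mode of the on-site pair is the pair operator of total momentum `m`**:
`Σ_x conj χ_m(x) • (c_{x↓} c_{x↑}) = Σ_k c_{m-k,↓} c_{k,↑}` (Fourier inversion of both factors and
`sum_weight_torusChar_mul_weight_torusChar_mul_conj`). BCS (1957) §II. [folklore] -/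
theorem sum_conj_torusChar_smul_onsitePair (m : TorusSite 2 L) :
    ∑ z : TorusSite 2 L, conj (torusChar m z) •
        (annihilation (orb (FermionTorus.ofTorusSite z) 1) * annihilation (orb (FermionTorus.ofTorusSite z) 0)) =
      ∑ k : TorusSite 2 L, momentumAnnihilation (m - k) 1 * momentumAnnihilation k 0 := by
  -- expand both annihilators in Bloch modes
  have hexp : ∀ z : TorusSite 2 L,
      annihilation (orb (FermionTorus.ofTorusSite z) 1) * annihilation (orb (FermionTorus.ofTorusSite z) 0) =
        ∑ a : TorusSite 2 L, ∑ b : TorusSite 2 L,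
          (torusFourierWeight 2 L * torusChar a z * (torusFourierWeight 2 L * torusChar b z)) •
            (momentumAnnihilation a 1 * momentumAnnihilation b 0) := by
    intro z
    rw [annihilation_orb_eq_sum_momentumAnnihilation, annihilation_orb_eq_sum_momentumAnnihilation,
      Finset.sum_mul_sum]
    refine Finset.sum_congr rfl fun a _ => Finset.sum_congr rfl fun b _ => ?_
    rw [smul_mul_smul_comm, FermionTorus.toTorusSite_ofTorusSite]
  simp_rw [hexp, Finset.smul_sum, smul_smul]
  -- exchange the sums and evaluate the character sum
  rw [Finset.sum_comm]
  have hinner : ∀ a : TorusSite 2 L,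
      ∑ z : TorusSite 2 L, ∑ b : TorusSite 2 L,
        (conj (torusChar m z) * (torusFourierWeight 2 L * torusChar a z * (torusFourierWeight 2 L * torusChar b z))) •
          (momentumAnnihilation a 1 * momentumAnnihilation b 0) =
      ∑ b : TorusSite 2 L, (if a + b = m then (1 : ℂ) else 0) •
          (momentumAnnihilation a 1 * momentumAnnihilation b 0) := by
    intro a
    rw [Finset.sum_comm]
    refine Finset.sum_congr rfl fun b _ => ?_
    rw [← Finset.sum_smul, ← sum_weight_torusChar_mul_weight_torusChar_mul_conj a b m]
    congr 1
    exact Finset.sum_congr rfl fun z _ => by ring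
  simp_rw [hinner, ite_smul, one_smul, zero_smul]
  -- `Σ_a Σ_b [a + b = m] c_{a↓} c_{b↑} = Σ_b c_{m-b,↓} c_{b,↑}`
  rw [Finset.sum_comm]
  refine Finset.sum_congr rfl fun b _ => ?_
  have he : ∀ a : TorusSite 2 L, (a + b = m) = (a = m - b) := fun a => propext eq_sub_iff_add_eq.symm
  simp_rw [he]
  rw [Finset.sum_ite_eq', if_pos (Finset.mem_univ _)]

/-- **THE ON-SITE REPULSION IN THE PAIR CHANNEL**: on the torus `(ℤ/Lℤ)²`,
`Σ_x n_{x↑} n_{x↓} = L⁻² Σ_m F_mᴴ F_m` with the pair operators `F_m = Σ_k c_{m-k,↓} c_{k,↑}` of total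
momentum `m` (`numberOp_mul_numberOp_eq`, the operator Plancherel identity
`sum_conjTranspose_mul_fourierMode` for the family `x ↦ c_{x↓}c_{x↑}`, and
`sum_conj_torusChar_smul_onsitePair`). BCS (1957) §II (the reduced form keeps only `m = 0`). [folklore] -/
theorem interaction_eq_sum_pairMomentum :
    (∑ x : FermionTorus 2 L, numberOp x 0 * numberOp x 1 :
        Matrix (Finset (Orb (FermionTorus 2 L))) (Finset (Orb (FermionTorus 2 L))) ℂ) =
      ((L : ℂ) ^ 2)⁻¹ • ∑ m : TorusSite 2 L,
        (∑ k : TorusSite 2 L, momentumAnnihilation (m - k) 1 * momentumAnnihilation k 0)ᴴ *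
          (∑ k : TorusSite 2 L, momentumAnnihilation (m - k) 1 * momentumAnnihilation k 0) := by
  have hP := sum_conjTranspose_mul_fourierMode (d := 2) (L := L)
    (fun z : TorusSite 2 L =>
      annihilation (orb (FermionTorus.ofTorusSite z) 1) * annihilation (orb (FermionTorus.ofTorusSite z) 0))
  simp only [sum_conj_torusChar_smul_onsitePair] at hP
  rw [hP, smul_smul, inv_mul_cancel₀ natCast_pow_ne_zero, one_smul, FermionTorus.sum_eq_sum_torusSite]
  exact Finset.sum_congr rfl fun z _ => numberOp_mul_numberOp_eq _

/-! ### Momentum-space CAR bookkeeping -/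

/-- `c_{k'σ'} n_{kσ} = n_{kσ} c_{k'σ'}` for different modes (adjoint of
`momentumNumber_mul_momentumCreation_of_ne`). [folklore] -/
theorem momentumAnnihilation_mul_momentumNumber_of_ne {k k' : TorusSite 2 L} {σ σ' : Fin 2}
    (h : ¬ (k = k' ∧ σ = σ')) :
    momentumAnnihilation k' σ' * momentumNumber k σ = momentumNumber k σ * momentumAnnihilation k' σ' := by
  have h' := congrArg conjTranspose (momentumNumber_mul_momentumCreation_of_ne h)
  simpa only [conjTranspose_mul, momentumCreation_conjTranspose, momentumNumber_conjTranspose] using h'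

/-! ### The pair operators of total momentum `m` on the paired vector -/

/-- Off-diagonal terms vanish: for `k ≠ k'`,
`⟨c_{m-k',↓}c_{k',↑} Φ_l, c_{m-k,↓}c_{k,↑} Φ_l⟩ = 0` (if `k ∉ l` the right vector is `0`; if `k ∈ l`,
move `n_{k↑}` from the left vector, where it acts as `1`, to the right one, where `n_{k↑} c_{k↑} = 0`). [folklore] -/
theorem star_pairTerm_dotProduct_pairTerm_of_ne (l : List (TorusSite 2 L)) (m : TorusSite 2 L)
    {k k' : TorusSite 2 L} (hkk' : k ≠ k') :
    star ((momentumAnnihilation (m - k') 1 * momentumAnnihilation k' 0) *ᵥ ((List.map (fun q : TorusSite 2 L => (pairMode q)ᴴ) l).prod *ᵥ (vacuum : Fock (Orb (FermionTorus 2 L))))) ⬝ᵥ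
      ((momentumAnnihilation (m - k) 1 * momentumAnnihilation k 0) *ᵥ ((List.map (fun q : TorusSite 2 L => (pairMode q)ᴴ) l).prod *ᵥ (vacuum : Fock (Orb (FermionTorus 2 L))))) = 0 := by
  by_cases hk : k ∈ l
  · have hn : momentumNumber k 0 *ᵥ ((List.map (fun q : TorusSite 2 L => (pairMode q)ᴴ) l).prod *ᵥ (vacuum : Fock (Orb (FermionTorus 2 L)))) = ((List.map (fun q : TorusSite 2 L => (pairMode q)ᴴ) l).prod *ᵥ (vacuum : Fock (Orb (FermionTorus 2 L)))) := momentumNumber_up_pairedState_of_mem hk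
    have h1 : ¬ (k = k' ∧ (0 : Fin 2) = 0) := fun h => hkk' h.1
    have h2 : ¬ (k = m - k' ∧ (0 : Fin 2) = 1) := fun h => absurd h.2 (by decide)
    have h3 : ¬ (k = m - k ∧ (0 : Fin 2) = 1) := fun h => absurd h.2 (by decide)
    have hA' : momentumAnnihilation (m - k') 1 * momentumAnnihilation k' 0 * momentumNumber k 0 =
        momentumNumber k 0 * (momentumAnnihilation (m - k') 1 * momentumAnnihilation k' 0) := by
      rw [Matrix.mul_assoc, momentumAnnihilation_mul_momentumNumber_of_ne h1, ← Matrix.mul_assoc,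
        momentumAnnihilation_mul_momentumNumber_of_ne h2, Matrix.mul_assoc]
    have hA'' : momentumNumber k 0 * (momentumAnnihilation (m - k') 1 * momentumAnnihilation k' 0)ᴴ =
        (momentumAnnihilation (m - k') 1 * momentumAnnihilation k' 0)ᴴ * momentumNumber k 0 := by
      have h := congrArg conjTranspose hA'
      rw [conjTranspose_mul, conjTranspose_mul (momentumNumber k 0), momentumNumber_conjTranspose] at h
      exact h
    have hnA : momentumNumber k 0 * (momentumAnnihilation (m - k) 1 * momentumAnnihilation k 0) = 0 := by
      rw [← Matrix.mul_assoc, ← momentumAnnihilation_mul_momentumNumber_of_ne h3, Matrix.mul_assoc,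
        momentumNumber_mul_momentumAnnihilation_self, Matrix.mul_zero]
    have e : (momentumAnnihilation (m - k') 1 * momentumAnnihilation k' 0 * momentumNumber k 0) *ᵥ ((List.map (fun q : TorusSite 2 L => (pairMode q)ᴴ) l).prod *ᵥ (vacuum : Fock (Orb (FermionTorus 2 L)))) =
        (momentumAnnihilation (m - k') 1 * momentumAnnihilation k' 0) *ᵥ ((List.map (fun q : TorusSite 2 L => (pairMode q)ᴴ) l).prod *ᵥ (vacuum : Fock (Orb (FermionTorus 2 L)))) := by
      rw [← mulVec_mulVec, hn]
    rw [← e, star_mulVec_dotProduct_mulVec, conjTranspose_mul, momentumNumber_conjTranspose, hA'',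
      Matrix.mul_assoc, hnA, Matrix.mul_zero, zero_mulVec, dotProduct_zero]
  · have e : (momentumAnnihilation (m - k) 1 * momentumAnnihilation k 0) *ᵥ ((List.map (fun q : TorusSite 2 L => (pairMode q)ᴴ) l).prod *ᵥ (vacuum : Fock (Orb (FermionTorus 2 L)))) = 0 := by
      rw [← mulVec_mulVec, momentumAnnihilation_up_pairedState_of_not_mem hk, mulVec_zero]
    rw [e, dotProduct_zero]

/-- Diagonal terms are Bloch occupations: for duplicate-free `l`,
`‖c_{m-k,↓}c_{k,↑} Φ_l‖² = ⟨Φ_l, n_{m-k,↓} n_{k,↑} Φ_l⟩ = [k ∈ l][k - m ∈ l]`. [folklore] -/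
theorem star_pairTerm_dotProduct_pairTerm_self {l : List (TorusSite 2 L)} (hl : l.Nodup)
    (m k : TorusSite 2 L) :
    star ((momentumAnnihilation (m - k) 1 * momentumAnnihilation k 0) *ᵥ ((List.map (fun q : TorusSite 2 L => (pairMode q)ᴴ) l).prod *ᵥ (vacuum : Fock (Orb (FermionTorus 2 L))))) ⬝ᵥ
      ((momentumAnnihilation (m - k) 1 * momentumAnnihilation k 0) *ᵥ ((List.map (fun q : TorusSite 2 L => (pairMode q)ᴴ) l).prod *ᵥ (vacuum : Fock (Orb (FermionTorus 2 L))))) =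
        if k ∈ l ∧ k - m ∈ l then 1 else 0 := by
  have h1 : ¬ (m - k = k ∧ (1 : Fin 2) = 0) := fun h => absurd h.2 (by decide)
  have hAA : (momentumAnnihilation (m - k) 1 * momentumAnnihilation k 0)ᴴ *
      (momentumAnnihilation (m - k) 1 * momentumAnnihilation k 0) =
        momentumNumber (m - k) 1 * momentumNumber k 0 := by
    rw [conjTranspose_mul, momentumAnnihilation_conjTranspose, momentumAnnihilation_conjTranspose,
      Matrix.mul_assoc, ← Matrix.mul_assoc (momentumCreation (m - k) 1), ← momentumNumber,
      ← Matrix.mul_assoc, ← momentumNumber_mul_momentumCreation_of_ne h1, Matrix.mul_assoc, ← momentumNumber]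
  rw [star_mulVec_dotProduct_mulVec, hAA, ← mulVec_mulVec]
  have hmk : m - k = -(k - m) := (neg_sub k m).symm
  by_cases hk : k ∈ l
  · rw [momentumNumber_up_pairedState_of_mem hk, hmk]
    by_cases hkm : k - m ∈ l
    · rw [momentumNumber_down_pairedState_of_mem hkm, star_pairedState_dotProduct_self hl, if_pos ⟨hk, hkm⟩]
    · rw [momentumNumber_down_pairedState_of_not_mem hkm, dotProduct_zero, if_neg (fun h => hkm h.2)]
  · rw [momentumNumber_up_pairedState_of_not_mem hk, mulVec_zero, dotProduct_zero, if_neg (fun h => hk h.1)]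

/-- **`⟨Φ_l, F_mᴴ F_m Φ_l⟩ = #{k ∈ l : k - m ∈ l}`** for the pair operator `F_m = Σ_k c_{m-k,↓}c_{k,↑}` of
total momentum `m` and duplicate-free `l` (as a sum of indicators). BCS (1957) §II. [folklore] -/
theorem star_pairedState_pairMomentum_expect {l : List (TorusSite 2 L)} (hl : l.Nodup) (m : TorusSite 2 L) :
    star (((List.map (fun q : TorusSite 2 L => (pairMode q)ᴴ) l).prod *ᵥ (vacuum : Fock (Orb (FermionTorus 2 L))))) ⬝ᵥ (((∑ k : TorusSite 2 L, momentumAnnihilation (m - k) 1 * momentumAnnihilation k 0)ᴴ *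
        (∑ k : TorusSite 2 L, momentumAnnihilation (m - k) 1 * momentumAnnihilation k 0)) *ᵥ ((List.map (fun q : TorusSite 2 L => (pairMode q)ᴴ) l).prod *ᵥ (vacuum : Fock (Orb (FermionTorus 2 L))))) =
      ∑ k : TorusSite 2 L, if k ∈ l ∧ k - m ∈ l then (1 : ℂ) else 0 := by
  rw [← star_mulVec_dotProduct_mulVec, sum_mulVec, star_sum, sum_dotProduct]
  refine Finset.sum_congr rfl fun k' _ => ?_
  rw [dotProduct_sum, Finset.sum_eq_single k']
  · exact star_pairTerm_dotProduct_pairTerm_self hl m k'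
  · intro k _ hk
    exact star_pairTerm_dotProduct_pairTerm_of_ne l m hk
  · intro h; exact absurd (Finset.mem_univ k') h

/-- The lattice count behind the doublon density: `Σ_m #{k ∈ l : k - m ∈ l} = |l|²` (for each `k ∈ l`
the map `m ↦ k - m` is a bijection of `(ℤ/Lℤ)²`). [folklore] -/
theorem sum_sum_ite_mem_and_sub_mem {l : List (TorusSite 2 L)} (hl : l.Nodup) :
    ∑ m : TorusSite 2 L, ∑ k : TorusSite 2 L, (if k ∈ l ∧ k - m ∈ l then (1 : ℂ) else 0) =
      ((l.length : ℂ)) ^ 2 := by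
  classical
  rw [Finset.sum_comm]
  have hcard : ((Finset.univ.filter fun q : TorusSite 2 L => q ∈ l).card : ℂ) = l.length := by
    have e : (Finset.univ.filter fun q : TorusSite 2 L => q ∈ l) = l.toFinset := by
      ext q; simp
    rw [e, List.toFinset_card_of_nodup hl]
  have hinner : ∀ k : TorusSite 2 L,
      ∑ m : TorusSite 2 L, (if k ∈ l ∧ k - m ∈ l then (1 : ℂ) else 0) =
        if k ∈ l then (l.length : ℂ) else 0 := by
    intro k
    by_cases hk : k ∈ l
    · simp only [hk, true_and, if_true]
      have hre : ∑ x : TorusSite 2 L, (if k - x ∈ l then (1 : ℂ) else 0) =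
          ∑ q : TorusSite 2 L, (if q ∈ l then (1 : ℂ) else 0) :=
        Equiv.sum_comp (Equiv.subLeft k) (fun q : TorusSite 2 L => if q ∈ l then (1 : ℂ) else 0)
      rw [hre, Finset.sum_boole, hcard]
    · simp [hk]
  simp_rw [hinner]
  rw [Finset.sum_ite, Finset.sum_const_zero, add_zero, Finset.sum_const, nsmul_eq_mul, hcard, sq]

/-- **THE DOUBLON DENSITY OF THE PAIRED FERMI SEA IS `n²/L²`**: for a duplicate-free list `l` of `n`
momenta, `Re⟨Φ_l, Σ_x n_{x↑} n_{x↓} Φ_l⟩ = n²/L²` — the up and down densities `n/L²` of the paramagnetic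
Slater determinant `Φ_l` are uncorrelated, so its Hartree–Fock interaction energy is exactly `U n²/L²`.
Penn (1966) §II; BCS (1957) §II. [folklore] -/
theorem re_expect_interaction_pairedState {l : List (TorusSite 2 L)} (hl : l.Nodup) :
    (star (((List.map (fun q : TorusSite 2 L => (pairMode q)ᴴ) l).prod *ᵥ (vacuum : Fock (Orb (FermionTorus 2 L))))) ⬝ᵥ ((∑ x : FermionTorus 2 L, numberOp x 0 * numberOp x 1 :
        Matrix (Finset (Orb (FermionTorus 2 L))) _ ℂ) *ᵥ ((List.map (fun q : TorusSite 2 L => (pairMode q)ᴴ) l).prod *ᵥ (vacuum : Fock (Orb (FermionTorus 2 L)))))).re = (l.length : ℝ) ^ 2 / (L : ℝ) ^ 2 := by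
  rw [interaction_eq_sum_pairMomentum, smul_mulVec, dotProduct_smul, sum_mulVec, dotProduct_sum]
  simp only [star_pairedState_pairMomentum_expect hl]
  rw [sum_sum_ite_mem_and_sub_mem hl, smul_eq_mul,
    show ((L : ℂ) ^ 2)⁻¹ * ((l.length : ℂ)) ^ 2 = (((l.length : ℝ) ^ 2 / (L : ℝ) ^ 2 : ℝ) : ℂ) by
      push_cast; ring,
    Complex.ofReal_re]

end Literature.MathematicalPhysics.QuantumLattice
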